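import Literature.Computability.QuantumComplexity.BQPSubsetAWPPCount
import Literature.Computability.QuantumComplexity.CountingSimulation
import HarnessLib

/-!
# `BQP ⊆ AWPP` (Fortnow–Rogers 1999, Thm. 3.1; Fenner 2003, Cor. 3.2): the assembly

Discharge (D-0014) of the named fact `Literature.Computability.QuantumComplexity.BQP_subset_AWPP`
(`CountingSimulation.lean`): **`BQP_subset_AWPP_holds`**, for the tree's `BQP` (polynomial-time
uniform oracle-free Clifford+`T` families, error `1/3`) and the tree's `AWPP` (Fenner's form: one
`GapP` function `g` and a polynomial `q` with `g(x)/2^{q(|x|)} ∈ [2/3, 1]` on members and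
`∈ [0, 1/3]` on non-members).

Printed proof (Fortnow–Rogers, §3). Lemma 3.2: for a polynomial-time quantum machine with
rational amplitudes there are `f ∈ GapP` and an `FP` denominator `5^{2t}` with
`Pr[accept] = f/5^{2t}` (Feynman path sums, after Adleman–DeMarrais–Huang); Thm. 3.1: hence
`BQP ⊆ AWPP` (the `AWPP` of Fenner–Fortnow–Kurtz–Li, arbitrary `FP` denominators and error
`2^{-r}`), and Fenner 2003 (Thm. 1.2 / Cor. 3.2) normalises `AWPP` to one `GapP` function, dyadic
denominators and constant error. Rendering for Clifford+`T`, whose acceptance probabilities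
`p ∈ ℤ[√2]/2^h` are irrational in general (so no exact `f/2^q` exists):

1. **The `GapP` function** (`BQPSubsetAWPPCount.lean`, `ADHCoWalk.lean`): with the coin
   polynomial `p₀ ≥ 2μ + 3` of `BQPSubsetPP.lean`, the witness languages `L₁, L₂ ∈ P` (`exists_gapPair`) over
   guesses of length `3p₀(|x|)` have `#L₁ - #L₂ = W · 2^{2p₀ - 2 - h}`, `W = 4𝔄 + 3𝔅` the
   Adleman–DeMarrais–Huang path-pair count (`CliffordTPathSums.lean`) and `h` the number of
   Hadamard gates; so `g = #L₁ - #L₂ + 2^{2p₀} ∈ GapP` has `g/2^{2p₀+1} = 1/2 + W/(8·2^h)`.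
2. **The error** (`adhW_approx`): `𝔄 + (√2/2)𝔅 = 2^h(2p - 1)` and the Galois-conjugate bound
   `|𝔅| ≤ √2·2^h` (`abs_adhB_le`) give `|1/2 + W/(8·2^h) - p| ≤ (3√2 - 4)/8 < 0.0325`.
3. **Amplification inside `GapP`** (`GapPRing.lean`): the cubic `A(t) = 3t² - 2t³` maps
   `[2/3 - 0.0325, 1 + 0.0325]` into `[2/3, 1]` and `[-0.0325, 1/3 + 0.0325]` into `[0, 1/3]`
   (`amp_of_mem`, `amp_of_not_mem`), and `3g²·2^{2p₀+1} - 2g³ ∈ GapP` realises `A(g/2^{2p₀+1})`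
   over the denominator `2^{6p₀+3}` — Fenner's form of `AWPP` with error exactly `1/3`.

The empty register (`|x| + ancillas = 0`, acceptance probability `0` by convention, `W = -4`,
`h = 0`) gives `g/2^{2p₀+1} = 0`, a rejected input, consistently.

## References

* L. Fortnow, J. Rogers, *Complexity limitations on quantum computation*, J. Comput. System Sci.
  59 (1999) 240–252 (arXiv:cs/9811023), §3: Thm. 3.1 (`BQP ⊆ AWPP`), Lemma 3.2.
* S. Fenner, *PP-lowness and a simple definition of AWPP*, Theory Comput. Syst. 36 (2003)
  199–212: Thm. 1.2, Cor. 3.2 (one `GapP` function, dyadic denominators, constant error).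
* S. Fenner, L. Fortnow, S. Kurtz, L. Li, *An oracle builder's toolkit*, Inform. and Comput. 182
  (2003) 95–136, §6.1 (`AWPP`; "BQP ⊆ AWPP").
* L. M. Adleman, J. DeMarrais, M.-D. A. Huang, *Quantum computability*, SIAM J. Comput. 26 (1997),
  §6, Lemma 6.10.
-/

noncomputable section

namespace Literature.Computability.QuantumComplexity

open _root_.Computability Polynomial Complexity Complexity.Classes Cryptography ADH AWPPBQP GapPRing
  Literature.Computability.Complexity.PPSharpP

namespace AWPPBQP

/-! ### The amplifying cubic `A(t) = 3t² - 2t³` -/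

/-- **Members are pushed into `[2/3, 1]`**: for `0.63 ≤ t ≤ 1.04`, `2/3 ≤ 3t² - 2t³ ≤ 1`
(`A` is increasing on `[0, 1]` with `A(0.63) > 2/3`, `1 - A(t) = (1 - t)²(1 + 2t) ≥ 0`, and
`A(t) ≥ 3 - 2t` for `t ≥ 1`). [cite: FennerFortnowKurtzLi2003IC, §6.1 p. 25 (remark after Def. 6.1: the ratio g(x)/2^q(n) can be amplified towards 0 or 1, so 2^-r(n) may be replaced by the constant 1/3)] -/
theorem amp_of_mem (t : ℝ) (h1 : 0.63 ≤ t) (h2 : t ≤ 1.04) :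
    2 / 3 ≤ 3 * t ^ 2 - 2 * t ^ 3 ∧ 3 * t ^ 2 - 2 * t ^ 3 ≤ 1 := by
  constructor
  · by_cases ht : t ≤ 1
    · nlinarith [mul_nonneg (sub_nonneg.2 h1) (sub_nonneg.2 ht),
        mul_nonneg (mul_nonneg (sub_nonneg.2 h1) (sub_nonneg.2 h1)) (sub_nonneg.2 ht),
        mul_nonneg (mul_nonneg (sub_nonneg.2 h1) (sub_nonneg.2 ht)) (sub_nonneg.2 ht),
        sq_nonneg (t - 0.63)]
    · have ht' : 1 ≤ t := (not_le.1 ht).le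
      nlinarith [mul_nonneg (mul_nonneg (sub_nonneg.2 ht') (by linarith : (0 : ℝ) ≤ t + 1))
        (by linarith : (0 : ℝ) ≤ 3 - 2 * t)]
  · nlinarith [mul_nonneg (sq_nonneg (1 - t)) (by linarith : (0 : ℝ) ≤ 1 + 2 * t)]

/-- **Non-members are pushed into `[0, 1/3]`**: for `-0.04 ≤ t ≤ 0.367`,
`0 ≤ 3t² - 2t³ ≤ 1/3` (`A(t) = t²(3 - 2t) ≥ 0`, `A` increasing on `[0, 1]` with
`A(0.367) < 1/3`, and `A(t) ≤ 3.08 t²` for `-0.04 ≤ t ≤ 0`). [cite: FennerFortnowKurtzLi2003IC, §6.1 p. 25 (remark after Def. 6.1: the ratio g(x)/2^q(n) can be amplified towards 0 or 1, so 2^-r(n) may be replaced by the constant 1/3)] -/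
theorem amp_of_not_mem (t : ℝ) (h1 : -0.04 ≤ t) (h2 : t ≤ 0.367) :
    0 ≤ 3 * t ^ 2 - 2 * t ^ 3 ∧ 3 * t ^ 2 - 2 * t ^ 3 ≤ 1 / 3 := by
  constructor
  · nlinarith [mul_nonneg (sq_nonneg t) (by linarith : (0 : ℝ) ≤ 3 - 2 * t)]
  · by_cases ht : 0 ≤ t
    · nlinarith [mul_nonneg (sub_nonneg.2 h2) ht,
        mul_nonneg (mul_nonneg (sub_nonneg.2 h2) (sub_nonneg.2 h2)) ht,
        mul_nonneg (mul_nonneg (sub_nonneg.2 h2) ht) ht,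
        sq_nonneg (t - 0.367)]
    · have ht' : t ≤ 0 := (not_le.1 ht).le
      nlinarith [mul_nonneg (sq_nonneg t) (by linarith : (0 : ℝ) ≤ -t),
        mul_nonneg (sub_nonneg.2 h1) (by linarith : (0 : ℝ) ≤ -t)]

/-! ### The path-pair count approximates the acceptance probability -/

/-- **`W/(8·2^h) + 1/2` is the acceptance probability up to `(3√2 - 4)/8 < 0.0325`**, written
multiplicatively: `|4·2^h(1 - 2p) + W| ≤ 0.26·2^h`. Proof: `𝔄 + (√2/2)𝔅 = 2^h(2p - 1)`
(`adhA_add_adhB_eq`), so `4·2^h(1 - 2p) + W = (3 - 2√2)𝔅`, and `|𝔅| ≤ √2·2^h` (the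
Galois-conjugate bound `abs_adhB_le`), `(3 - 2√2)√2 = 3√2 - 4 < 0.26`. This replaces the exact
rational path sum of the printed proof. [cite: FortnowRogers1999JCSS, Lemma 3.2 (Pr[M accepts x] = f(x)/g(x))] -/
theorem adhW_approx {M : ℕ} (gs : List (QGate cliffordT M)) (hgs : ∀ g ∈ gs, g.IsOracleFree) (w : QReg M)
    (hM : 0 < M) :
    -(0.26 * (2 : ℝ) ^ hCount gs) ≤ 4 * (2 : ℝ) ^ hCount gs * (1 - 2 * probAcc omega gs w hM) + adhW gs w ∧
      4 * (2 : ℝ) ^ hCount gs * (1 - 2 * probAcc omega gs w hM) + adhW gs w ≤ 0.26 * (2 : ℝ) ^ hCount gs := by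
  have h1 := adhA_add_adhB_eq (ε := 1) omega_pow_two omega_pow_eight star_omega omega_mul_star
    (fun d hd => by rw [omega_pow_re d hd]; ring) gs hgs w hM
  have hB := abs_le.1 (abs_adhB_le gs hgs w hM)
  have hpow : (0 : ℝ) < (2 : ℝ) ^ hCount gs := by positivity
  have hs := sqrt_two_gt
  have hs' := sqrt_two_lt
  have hsq : Real.sqrt 2 * Real.sqrt 2 = 2 := Real.mul_self_sqrt (by norm_num)
  have hW : (adhW gs w : ℝ) = 4 * adhA gs w + 3 * adhB gs w := by unfold adhW; push_cast; ring
  have key : 4 * (2 : ℝ) ^ hCount gs * (1 - 2 * probAcc omega gs w hM) + adhW gs w =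
      (3 - 2 * Real.sqrt 2) * adhB gs w := by rw [hW]; linarith
  rw [key]
  have h3 : (0 : ℝ) ≤ 3 - 2 * Real.sqrt 2 := by linarith
  constructor
  · nlinarith [mul_nonneg h3 (by linarith [hB.1] : (0 : ℝ) ≤ adhB gs w + Real.sqrt 2 * 2 ^ hCount gs)]
  · nlinarith [mul_nonneg h3 (by linarith [hB.2] : (0 : ℝ) ≤ Real.sqrt 2 * 2 ^ hCount gs - adhB gs w)]

/-- On the empty register: `W = -4` and `h = 0` (no gate fits on `0` wires). [folklore] -/
theorem adhW_hCount_of_zero {M : ℕ} (hM : M = 0) (gs : List (QGate cliffordT M)) (w : QReg M) :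
    adhW gs w = -4 ∧ hCount gs = 0 := by
  subst hM
  rw [show gs = [] from gates_eq_nil_of_zero ⟨gs⟩]
  exact ⟨adhW_nil_zero w, hCount_nil⟩

/-! ### From the cubic to the `AWPP` thresholds -/

/-- **The thresholds in integers.** If `g = t·D` with `D = 2^N > 0` then the `AWPP` conditions on
`g_A = 3g²D - 2g³ = D³·A(t)` against `2^{3N} = D³` are the bounds on `A(t) = 3t² - 2t³`.
[cite: Fenner2003TOCS, Thm. 1.2 and Cor. 3.2 (AWPP via one GapP function, dyadic denominators, error 1/3)] -/
theorem thresholds_of_amp (g : ℤ) (N : ℕ) (t : ℝ) (ht : (g : ℝ) = t * (2 : ℝ) ^ N) :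
    (2 / 3 ≤ 3 * t ^ 2 - 2 * t ^ 3 → 2 * (2 : ℤ) ^ (3 * N) ≤ 3 * (3 * (g * g) * (2 : ℤ) ^ N - 2 * (g * g * g))) ∧
    (3 * t ^ 2 - 2 * t ^ 3 ≤ 1 → 3 * (g * g) * (2 : ℤ) ^ N - 2 * (g * g * g) ≤ (2 : ℤ) ^ (3 * N)) ∧
    (0 ≤ 3 * t ^ 2 - 2 * t ^ 3 → 0 ≤ 3 * (g * g) * (2 : ℤ) ^ N - 2 * (g * g * g)) ∧
    (3 * t ^ 2 - 2 * t ^ 3 ≤ 1 / 3 → 3 * (3 * (g * g) * (2 : ℤ) ^ N - 2 * (g * g * g)) ≤ (2 : ℤ) ^ (3 * N)) := by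
  set D : ℝ := (2 : ℝ) ^ N with hD
  have hDpos : 0 < D := by positivity
  have hD3 : 0 < D ^ 3 := by positivity
  have hgA : ((3 * (g * g) * (2 : ℤ) ^ N - 2 * (g * g * g) : ℤ) : ℝ) = D ^ 3 * (3 * t ^ 2 - 2 * t ^ 3) := by
    push_cast
    rw [ht]
    ring
  have hP : (((2 : ℤ) ^ (3 * N) : ℤ) : ℝ) = D ^ 3 := by
    push_cast
    rw [hD, ← pow_mul, mul_comm]
  refine ⟨fun h => ?_, fun h => ?_, fun h => ?_, fun h => ?_⟩
  · have key : ((2 * (2 : ℤ) ^ (3 * N) : ℤ) : ℝ) ≤ ((3 * (3 * (g * g) * (2 : ℤ) ^ N - 2 * (g * g * g)) : ℤ) : ℝ) := by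
      rw [Int.cast_mul, Int.cast_mul 3, hgA, hP]
      push_cast
      nlinarith
    exact_mod_cast key
  · have key : ((3 * (g * g) * (2 : ℤ) ^ N - 2 * (g * g * g) : ℤ) : ℝ) ≤ (((2 : ℤ) ^ (3 * N) : ℤ) : ℝ) := by
      rw [hgA, hP]
      nlinarith
    exact_mod_cast key
  · have key : ((0 : ℤ) : ℝ) ≤ ((3 * (g * g) * (2 : ℤ) ^ N - 2 * (g * g * g) : ℤ) : ℝ) := by
      rw [hgA, Int.cast_zero]
      positivity
    exact_mod_cast key
  · have key : ((3 * (3 * (g * g) * (2 : ℤ) ^ N - 2 * (g * g * g)) : ℤ) : ℝ) ≤ (((2 : ℤ) ^ (3 * N) : ℤ) : ℝ) := by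
      rw [Int.cast_mul, hgA, hP]
      push_cast
      nlinarith
    exact_mod_cast key

end AWPPBQP

open AWPPBQP

/-! ### The theorem -/

/-- **`BQP ⊆ AWPP`** (Fortnow–Rogers 1999, Thm. 3.1, in Fenner's form of `AWPP`). For `L ∈ BQP`
decided by the uniform oracle-free Clifford+`T` family `F` with coin polynomial `p₀ ≥ 2μ + 3`:
the `GapP` function `g = #L₁ - #L₂ + 2^{2p₀}` (`AWPPBQP.exists_gapPair`) satisfies
`g/2^{2p₀+1} = 1/2 + W/(8·2^h) = p ± 0.0325` (`adhW_approx`), `p` the acceptance probability, and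
the `GapP` function `3g²·2^{2p₀+1} - 2g³` (`GapPRing.cubic_mem_GapP`) with the polynomial `6p₀ + 3`
witnesses `L ∈ AWPP`: members have `p ≥ 2/3`, hence value in `[2/3, 1]` (`amp_of_mem`), non-members
`p ≤ 1/3`, hence value in `[0, 1/3]` (`amp_of_not_mem`). Discharges the named fact
`BQP_subset_AWPP`. [cite: FortnowRogers1999JCSS, Thm. 3.1 and Lemma 3.2 (arXiv numbering, p. 6)] [cite: FennerFortnowKurtzLi2003IC, §6.1 Def. 6.1 and p. 25 (BQP ⊆ AWPP; constant error 1/3)] [cite: Fenner2003TOCS, Thm. 1.2 and Cor. 3.2] -/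
theorem BQP_subset_AWPP_holds : BQP_subset_AWPP := by
  intro L hL
  obtain ⟨F, hF, hU, hacc⟩ := ClassBQP.mem_BQP_iff.1 hL
  obtain ⟨p₀, hp₀⟩ := exists_coinPoly (F := F) hU
  obtain ⟨L₁, L₂, hL₁, hL₂, hpair⟩ := exists_gapPair hF hU p₀
  -- the GapP function `g = #L₁ - #L₂ + 2^{2p₀}`
  set f₁ : List Bool → ℕ := fun x => countWitnesses L₁ ((3 * p₀).eval x.length) x with hf₁def
  set f₂ : List Bool → ℕ := fun x => countWitnesses L₂ ((3 * p₀).eval x.length) x with hf₂def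
  have hf₁ : f₁ ∈ SharpP := ⟨L₁, hL₁, 3 * p₀, fun x => rfl⟩
  have hf₂ : f₂ ∈ SharpP := ⟨L₂, hL₂, 3 * p₀, fun x => rfl⟩
  have hg₀ : (fun x => (f₁ x : ℤ) - f₂ x) ∈ GapP := ⟨f₁, hf₁, f₂, hf₂, fun x => rfl⟩
  set g : List Bool → ℤ := fun x => ((f₁ x : ℤ) - f₂ x) + (2 : ℤ) ^ (2 * p₀).eval x.length with hgdef
  have hg : g ∈ GapP := add_mem_GapP hg₀ (two_pow_mem_GapP (2 * p₀))
  refine mem_AWPP_iff.2 ⟨fun x => 3 * (g x * g x) * (2 : ℤ) ^ (2 * p₀ + 1).eval x.length - 2 * (g x * g x * g x),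
    cubic_mem_GapP hg (2 * p₀ + 1), 6 * p₀ + 3, fun x => ?_⟩
  -- one input `x`
  set gs := (F.circ x.length).gates with hgs
  set μ := gs.length with hμ
  set N := (2 * p₀ + 1).eval x.length with hN
  have hpx := hp₀ x.length
  rw [← hgs, ← hμ] at hpx
  have hNe : N = 2 * p₀.eval x.length + 1 := by simp [hN, eval_add, eval_mul]
  have h6 : (6 * p₀ + 3).eval x.length = 3 * N := by
    rw [hNe]; simp [eval_add, eval_mul]; ring
  rw [h6]
  -- the value of `g x`
  have hh : hCount gs ≤ μ := hCount_le_length gs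
  obtain ⟨f, hf⟩ : ∃ f, 2 * p₀.eval x.length = 3 * μ + 3 + f := ⟨2 * p₀.eval x.length - (3 * μ + 3), by omega⟩
  obtain ⟨r, hr⟩ : ∃ r, p₀.eval x.length = μ + μ + r := ⟨p₀.eval x.length - (μ + μ), by omega⟩
  have hlen : (3 * p₀).eval x.length = μ + (p₀.eval x.length + (μ + (μ + (3 + f)))) := by
    simp only [eval_mul, eval_ofNat]; omega
  have hgap : (f₁ x : ℤ) - f₂ x = 2 ^ (μ - hCount gs) * 2 ^ (μ + μ) * 2 ^ (f + 1) * adhW gs (w₀ F x) := by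
    simp only [hf₁def, hf₂def, countWitnesses_eq_cnt, hlen]
    exact hpair x r f hr
  obtain ⟨e, he⟩ : ∃ e, e = μ - hCount gs + (μ + μ) + (f + 1) := ⟨_, rfl⟩
  have he' : e + (hCount gs + 3) = N := by omega
  have he'' : e + (hCount gs + 2) = 2 * p₀.eval x.length := by omega
  have hgx : g x = 2 ^ e * adhW gs (w₀ F x) + 2 ^ (2 * p₀.eval x.length) := by
    simp only [hgdef, eval_mul, eval_ofNat]
    rw [hgap, he]
    ring
  -- the real number `t = g x / 2^N = 1/2 + W/(8·2^h)`
  set X : ℝ := (2 : ℝ) ^ hCount gs with hX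
  have hXpos : 0 < X := by positivity
  set t : ℝ := 1 / 2 + (adhW gs (w₀ F x) : ℝ) / (8 * X) with ht
  have hgt : (g x : ℝ) = t * (2 : ℝ) ^ N := by
    rw [hgx, ← he', ← he'']
    push_cast
    rw [ht, hX, pow_add, pow_add, pow_add, pow_add]
    field_simp
    ring
  obtain ⟨T1, T2, T3, T4⟩ := thresholds_of_amp (g x) N t hgt
  -- the acceptance probability
  by_cases hM : 0 < x.length + F.ancillas x.length
  · have hprob := acceptProbOn_eq_probAcc hF 0 x hM
    obtain ⟨hlo, hhi⟩ := adhW_approx gs (hF x.length) (w₀ F x) hM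
    have p0 := probAcc_nonneg (ζ := omega) gs (w₀ F x) hM
    have p1 := probAcc_le_one omega_mul_star gs (w₀ F x) hM
    -- `8X (t - p) = 4X(1 - 2p) + W`
    have htp : 8 * X * (t - probAcc omega gs (w₀ F x) hM) =
        4 * X * (1 - 2 * probAcc omega gs (w₀ F x) hM) + adhW gs (w₀ F x) := by
      rw [ht]; field_simp; ring
    constructor
    · intro hx
      have h23 : 2 / 3 ≤ probAcc omega gs (w₀ F x) hM := by
        have h := (hacc x).1 hx
        rw [hprob] at h
        exact h
      have hb1 : 0.63 ≤ t := by nlinarith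
      have hb2 : t ≤ 1.04 := by nlinarith
      obtain ⟨a1, a2⟩ := amp_of_mem t hb1 hb2
      exact ⟨T1 a1, T2 a2⟩
    · intro hx
      have h13 : probAcc omega gs (w₀ F x) hM ≤ 1 / 3 := by
        have h := (hacc x).2 hx
        rw [hprob] at h
        exact h
      have hb1 : -0.04 ≤ t := by nlinarith
      have hb2 : t ≤ 0.367 := by nlinarith
      obtain ⟨a1, a2⟩ := amp_of_not_mem t hb1 hb2
      exact ⟨T3 a1, T4 a2⟩
  · have hM0 : x.length + F.ancillas x.length = 0 := by omega
    obtain ⟨hW4, hh0⟩ := adhW_hCount_of_zero hM0 gs (w₀ F x)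
    have ht0 : t = 0 := by
      rw [ht, hX, hW4, hh0]
      norm_num
    constructor
    · intro hx
      have h := (hacc x).1 hx
      rw [acceptProbOn_eq_zero (F := F) 0 x hM0] at h
      norm_num at h
    · intro _
      obtain ⟨a1, a2⟩ := amp_of_not_mem t (by rw [ht0]; norm_num) (by rw [ht0]; norm_num)
      exact ⟨T3 a1, T4 a2⟩

end Literature.Computability.QuantumComplexity

end
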